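import Summits.RiemannHypothesis.RiemannHypothesis.Theorems.MotivicDoorArchResidualSecondOrder
import HarnessLib

/-!
# Motivic door (Connes–Consani): the constant term of the decreed diagonal

Honest framing (cell `pub-rhdoor`, cc-3, verbatim): "lottery ticket at the motivic door; RH
probability negligible; consolation prizes are real: a new semi-local Weil-positivity theorem, or a
located gap in the Connes–Consani programme, plus the ff-door theorem".  No RH content below;
value = theorem.

`MotivicDoorDiagonalAsymptotics` proved, for a real test `u` with `supp u ⊆ [-R, R]`, `F = u ⋆ ũ`,
`k = F + F(−·)`, `u_E(t) = E u(Et)`, `f_E = toMul u_E` (`E = 1 + η`), the expansion of the decreed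
self-pairing `𝔰 = ccPairing` (Connes–Consani, arXiv:1805.10501 §3; Connes, arXiv:1509.05576 §4.1)
`2𝔰(f_E,f_E) = −‖u‖₂² E log E − c(u) E + O(1)`, `c(u) = ½Re 𝓔(F) − log(2π)‖u‖₂²`, the `O(1)`
being `−E·Re(½∫₀^∞ k_r(x) k(Ex) dx)`.  With `k_r(0⁺) = −½` to first order
(`MotivicDoorArchResidualSecondOrder`) that `O(1)` is here IDENTIFIED: it converges, to `¼(∫u)²`.

PROVED (RH-free, Suzuki-free):
* `two_mul_ccPairing_approxDiagonal_add_eq`: the exact identity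
  `2𝔰(f_E,f_E) + ‖u‖₂² E log E + c(u) E = −E·Re(½∫₀^∞ k_r(x) k(Ex) dx)` for `E log 2 ≥ 2R`.
* `abs_two_mul_ccPairing_approxDiagonal_sub_const_le`:
  `|2𝔰(f_E,f_E) + ‖u‖₂² E log E + c(u) E − ¼(∫u)²| ≤ R/(4E) · ∫₀^∞‖k‖` — the constant term is
  `¼(∫u)²` (`= −k_r(0⁺)·½∫₀^∞ k`, `∫₀^∞ k = (∫u)²`): finite, nonnegative, and depending on `u` only
  through its mass `∫u`; `tendsto_two_mul_ccPairing_approxDiagonal_add`: the limit form.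
* `tendsto_ccPairing_approxDiagonal_renormalised_sub_masses`: equivalently, with the bidegree
  `(∫f_E d⋆u, ∫f_E du) → (∫u, ∫u)` of the approximants (`MotivicDoorDiagonalDivergence`):
  `𝔰(f_E,f_E) + ½‖u‖₂² E log E + ½c(u) E − ⅛(∫f_E d⋆u)(∫f_E du) → 0`.

DERIVED reading (gap G3 of the cell's LOCATED-GAP.md; no claim beyond the theorems): along the
approximants of `(∫u)·Δ` the decreed self-intersection diverges with two PROFILE-DEPENDENT
counterterms (`‖u‖₂²`, `c(u)`), while the renormalised finite part `⅛·d⋆(Δ)d(Δ)` is UNIVERSAL in the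
bidegree.  A surface / Riemann–Roch formalism on a square of `Spec ℤ` reproducing `𝔰` must supply
exactly this renormalisation of `Δ•Δ`: a constraint on the missing object, not evidence about RH.
-/

noncomputable section

set_option linter.dupNamespace false

open Complex Set MeasureTheory Filter Topology Literature.NumberTheory.LFunctions
open Literature.NumberTheory.ConnesConsani2019
open Summit.RiemannHypothesis.RiemannHypothesis.Theorems.MotivicDoor.ArchLogLaplacian

namespace Summit.RiemannHypothesis.RiemannHypothesis.Theorems.MotivicDoor.ConnesConsani

/-! ## 1. The decreed diagonal to `o(1)`: the constant term is `¼(∫u)²` -/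

section Diagonal

variable {u : ℝ → ℝ}

/-- **The renormalised diagonal, exactly.**  For a real test `u` supported in `[-R, R]`,
`u_E(t) = E u(Et)` (`E = 1 + η`, `f_E = toMul u_E`), `F = u ⋆ ũ`, `k = weilSymm F`,
`c(u) = ½Re 𝓔(F) − log(2π)‖u‖₂²`: whenever `E log 2 ≥ 2R`,
`2𝔰(f_E,f_E) + ‖u‖₂² E log E + c(u) E = −E · Re(½∫₀^∞ k_r(x) k(Ex) dx)`
(the polar terms cancel and there is no prime below `log 2`; this is the identity behind
`abs_two_mul_ccPairing_approxDiagonal_add_le`).  PROVED. -/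
theorem two_mul_ccPairing_approxDiagonal_add_eq (hu : IsWeilTest fun t ↦ (u t : ℂ)) {R : ℝ}
    (hsupp : tsupport (fun t ↦ (u t : ℂ)) ⊆ Icc (-R) R) {η : ℝ} (hη : -1 < η)
    (hRη : 2 * R ≤ Real.log 2 * (1 + η)) :
    2 * ccPairing (toMul fun t ↦ (1 + η) * u ((1 + η) * t))
          (toMul fun t ↦ (1 + η) * u ((1 + η) * t)) +
        (∫ t, ‖(u t : ℂ)‖ ^ 2) * ((1 + η) * Real.log (1 + η)) +
        (1 / 2 * (logLaplacianEnergy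
            (weilConv (fun t ↦ (u t : ℂ)) (weilReflect fun t ↦ (u t : ℂ)))).re -
          Real.log (2 * Real.pi) * ∫ t, ‖(u t : ℂ)‖ ^ 2) * (1 + η) =
      -((1 + η) * ((1 / 2 : ℂ) * ∫ x in Ioi (0 : ℝ), (archResidualKernel x : ℂ) *
          weilSymm (weilConv (fun t ↦ (u t : ℂ)) (weilReflect fun t ↦ (u t : ℂ)))
            ((1 + η) * x)).re) := by
  have hc : 0 < 1 + η := by linarith
  set g : ℝ → ℂ := fun t ↦ (u t : ℂ)
  -- `2𝔰 = P(u_E) − Re Q(u_E)`, `Re Q(u_E) = E · Re Q(weilDilate η u)`, dilation law, no primes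
  rw [two_mul_ccPairing_toMul_eq (isWeilTest_approxDiagonal hu hη),
    re_weilQuadratic_approxDiagonal u hη, re_weilQuadratic_weilDilate_eq_logLaplacian hu hη,
    weilPrimeTerm_dilate_eq_zero hu hη hsupp hRη, Complex.zero_re, sub_zero]
  -- `P(u_E) = E · Re(polar term of F_E)`
  have hP : weilPoleForm (fun t ↦ (((1 + η) * u ((1 + η) * t) : ℝ) : ℂ)) =
      (1 + η) * (weilPolarTerm (fun t ↦ weilConv g (weilReflect g) ((1 + η) * t))).re := by
    rw [ofReal_approxDiagonal_eq u hη, ← weilConv_weilDilate_weilReflect g hη,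
      weilPolarTerm_weilConv_weilReflect_re (hu.weilDilate hη)]
    set w : ℝ → ℂ := weilDilate η g
    have e : ∀ m : ℝ → ℂ, ∫ t : ℝ, (Real.sqrt (1 + η) : ℂ) * w t * m t =
        (Real.sqrt (1 + η) : ℂ) * ∫ t : ℝ, w t * m t := fun m ↦ by
      rw [← integral_const_mul]
      exact integral_congr_ae (Eventually.of_forall fun t ↦ by ring)
    unfold weilPoleForm
    rw [e, e, norm_mul, norm_mul, mul_pow, mul_pow, Complex.norm_real,
      Real.norm_of_nonneg (Real.sqrt_nonneg _), Real.sq_sqrt hc.le]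
    ring
  rw [hP]
  ring

/-- **The constant term of the decreed diagonal is `¼(∫u)²`, with rate.**  Under the hypotheses of
`two_mul_ccPairing_approxDiagonal_add_eq`:
`|2𝔰(f_E,f_E) + ‖u‖₂² E log E + c(u) E − ¼(∫u)²| ≤ R/(4E) · ∫₀^∞‖k‖`,
i.e. `𝔰(f_E,f_E) = −½‖u‖₂² E log E − ½c(u) E + ⅛(∫u)² + O(E⁻¹)`: after the two divergent
(profile-dependent) archimedean counterterms, the decreed self-intersection of the approximants of
`(∫u)·Δ` has a FINITE limit depending on `u` only through its mass (`∫₀^∞ k = (∫u)²`,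
`k_r(0⁺) = −½`).
RH-free, Suzuki-free.  PROVED. -/
theorem abs_two_mul_ccPairing_approxDiagonal_sub_const_le (hu : IsWeilTest fun t ↦ (u t : ℂ))
    {R : ℝ} (hsupp : tsupport (fun t ↦ (u t : ℂ)) ⊆ Icc (-R) R) {η : ℝ} (hη : -1 < η)
    (hRη : 2 * R ≤ Real.log 2 * (1 + η)) :
    |2 * ccPairing (toMul fun t ↦ (1 + η) * u ((1 + η) * t))
          (toMul fun t ↦ (1 + η) * u ((1 + η) * t)) +
        (∫ t, ‖(u t : ℂ)‖ ^ 2) * ((1 + η) * Real.log (1 + η)) +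
        (1 / 2 * (logLaplacianEnergy
            (weilConv (fun t ↦ (u t : ℂ)) (weilReflect fun t ↦ (u t : ℂ)))).re -
          Real.log (2 * Real.pi) * ∫ t, ‖(u t : ℂ)‖ ^ 2) * (1 + η) -
        1 / 4 * (∫ t, u t) ^ 2| ≤
      R / (4 * (1 + η)) * ∫ x in Ioi (0 : ℝ),
        ‖weilSymm (weilConv (fun t ↦ (u t : ℂ)) (weilReflect fun t ↦ (u t : ℂ))) x‖ := by
  have hc : 0 < 1 + η := by linarith
  set g : ℝ → ℂ := fun t ↦ (u t : ℂ) with hgdef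
  have hF : IsWeilTest (weilConv g (weilReflect g)) := hu.weilConv hu.weilReflect
  have hsuppF : tsupport (weilConv g (weilReflect g)) ⊆ Icc (-(2 * R)) (2 * R) :=
    tsupport_weilConv_weilReflect_subset hu.2 hsupp
  have hl2 : Real.log 2 ≤ 1 := by have := Real.log_le_sub_one_of_pos two_pos; linarith
  have hSE : 2 * R ≤ 1 + η :=
    hRη.trans (by nlinarith [hl2, hc.le] : Real.log 2 * (1 + η) ≤ 1 + η)
  rw [two_mul_ccPairing_approxDiagonal_add_eq hu hsupp hη hRη]
  set r : ℂ := (1 / 2 : ℂ) * ∫ x in Ioi (0 : ℝ), (archResidualKernel x : ℂ) *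
    weilSymm (weilConv g (weilReflect g)) ((1 + η) * x) with hrdef
  set I : ℂ := ∫ x in Ioi (0 : ℝ), weilSymm (weilConv g (weilReflect g)) x with hIdef
  have hI : I = (((∫ t, u t) ^ 2 : ℝ) : ℂ) := by
    rw [hIdef, integral_Ioi_weilSymm_weilConv_weilReflect hu, integral_complex_ofReal,
      Complex.norm_real, Real.norm_eq_abs, sq_abs]
  have hres := norm_archResidual_comp_mul_add_le hF hsuppF hc hSE
  have key : -((1 + η) * r.re) - 1 / 4 * (∫ t, u t) ^ 2 =
      -((1 + η) * (r + (1 / (4 * (1 + η)) : ℂ) * I).re) := by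
    have e1 : (1 / (4 * (1 + η)) : ℂ) * I =
        (((1 / (4 * (1 + η)) * (∫ t, u t) ^ 2 : ℝ)) : ℂ) := by
      rw [hI]; push_cast; ring
    rw [Complex.add_re, e1, Complex.ofReal_re]
    field_simp
    ring
  rw [key, abs_neg, abs_mul, abs_of_pos hc]
  have h1 : |(r + (1 / (4 * (1 + η)) : ℂ) * I).re| ≤ 2 * R / (8 * (1 + η) ^ 2) *
      ∫ x in Ioi (0 : ℝ), ‖weilSymm (weilConv g (weilReflect g)) x‖ := by
    refine (Complex.abs_re_le_norm _).trans ?_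
    rw [show (1 / (4 * (1 + η)) : ℂ) = (1 / (4 * ((1 + η : ℝ) : ℂ)) : ℂ) by push_cast; ring]
    exact hres
  have hIn : 0 ≤ ∫ x in Ioi (0 : ℝ), ‖weilSymm (weilConv g (weilReflect g)) x‖ :=
    integral_nonneg fun _ ↦ norm_nonneg _
  calc (1 + η) * |(r + (1 / (4 * (1 + η)) : ℂ) * I).re|
      ≤ (1 + η) * (2 * R / (8 * (1 + η) ^ 2) *
          ∫ x in Ioi (0 : ℝ), ‖weilSymm (weilConv g (weilReflect g)) x‖) := by gcongr
    _ = R / (4 * (1 + η)) * ∫ x in Ioi (0 : ℝ), ‖weilSymm (weilConv g (weilReflect g)) x‖ := by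
      field_simp
      ring

/-- **`2𝔰(f_E,f_E) + ‖u‖₂² E log E + c(u) E → ¼(∫u)²`** as `E = 1 + η → ∞`.  PROVED. -/
theorem tendsto_two_mul_ccPairing_approxDiagonal_add (hu : IsWeilTest fun t ↦ (u t : ℂ))
    {R : ℝ} (hsupp : tsupport (fun t ↦ (u t : ℂ)) ⊆ Icc (-R) R) :
    Tendsto (fun η : ℝ ↦ 2 * ccPairing (toMul fun t ↦ (1 + η) * u ((1 + η) * t))
          (toMul fun t ↦ (1 + η) * u ((1 + η) * t)) +
        (∫ t, ‖(u t : ℂ)‖ ^ 2) * ((1 + η) * Real.log (1 + η)) +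
        (1 / 2 * (logLaplacianEnergy
            (weilConv (fun t ↦ (u t : ℂ)) (weilReflect fun t ↦ (u t : ℂ)))).re -
          Real.log (2 * Real.pi) * ∫ t, ‖(u t : ℂ)‖ ^ 2) * (1 + η))
      atTop (𝓝 (1 / 4 * (∫ t, u t) ^ 2)) := by
  set L : ℝ := 1 / 4 * (∫ t, u t) ^ 2
  set C : ℝ := R / 4 * ∫ x in Ioi (0 : ℝ),
    ‖weilSymm (weilConv (fun t ↦ (u t : ℂ)) (weilReflect fun t ↦ (u t : ℂ))) x‖
  set s : ℝ → ℝ := fun η ↦ 2 * ccPairing (toMul fun t ↦ (1 + η) * u ((1 + η) * t))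
          (toMul fun t ↦ (1 + η) * u ((1 + η) * t)) +
        (∫ t, ‖(u t : ℂ)‖ ^ 2) * ((1 + η) * Real.log (1 + η)) +
        (1 / 2 * (logLaplacianEnergy
            (weilConv (fun t ↦ (u t : ℂ)) (weilReflect fun t ↦ (u t : ℂ)))).re -
          Real.log (2 * Real.pi) * ∫ t, ‖(u t : ℂ)‖ ^ 2) * (1 + η)
  have h1 : Tendsto (fun η : ℝ ↦ 1 + η) atTop atTop :=
    tendsto_atTop_add_const_left atTop 1 tendsto_id
  have hC : Tendsto (fun η : ℝ ↦ C / (1 + η)) atTop (𝓝 0) := tendsto_const_nhds.div_atTop h1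
  have hr : Tendsto (fun η : ℝ ↦ s η - L) atTop (𝓝 0) := by
    refine squeeze_zero_norm' ?_ hC
    have hl2 : 0 < Real.log 2 := Real.log_pos one_lt_two
    filter_upwards [eventually_ge_atTop (max 0 (2 * R / Real.log 2 - 1))] with η hη
    have hη0 : 0 ≤ η := le_trans (le_max_left _ _) hη
    have hη1 : -1 < η := by linarith
    have hRη : 2 * R ≤ Real.log 2 * (1 + η) := by
      have : 2 * R / Real.log 2 ≤ 1 + η := by linarith [le_max_right 0 (2 * R / Real.log 2 - 1)]
      rw [div_le_iff₀ hl2] at this; linarith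
    rw [Real.norm_eq_abs]
    have h := abs_two_mul_ccPairing_approxDiagonal_sub_const_le hu hsupp hη1 hRη
    have e : R / (4 * (1 + η)) * ∫ x in Ioi (0 : ℝ),
        ‖weilSymm (weilConv (fun t ↦ (u t : ℂ)) (weilReflect fun t ↦ (u t : ℂ))) x‖ =
        C / (1 + η) := by
      simp only [C]; field_simp
    rw [← e]
    exact h
  simpa only [sub_add_cancel, zero_add] using hr.add_const L

/-- **Renormalised `Δ•Δ = ⅛ ·` (bidegree product) `+ o(1)`.**  With the bidegree
`(∫f_E d⋆u, ∫f_E du) → (∫u, ∫u)` of the approximants (`tendsto_massDstar_approxDiagonal`,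
`tendsto_massDu_approxDiagonal`):
`𝔰(f_E,f_E) + ½‖u‖₂² E log E + ½c(u) E − ⅛ (∫f_E d⋆u)(∫f_E du) → 0`.
DERIVED reading (G3): a Riemann–Roch on a square of `Spec ℤ` reproducing `𝔰` must renormalise the
diagonal by the two profile-dependent archimedean counterterms, after which the self-intersection of
the diagonal class is universal, `⅛ d⋆(Δ) d(Δ)`; a constraint on the missing object, no RH content.
PROVED. -/
theorem tendsto_ccPairing_approxDiagonal_renormalised_sub_masses
    (hu : IsWeilTest fun t ↦ (u t : ℂ)) {R : ℝ}
    (hsupp : tsupport (fun t ↦ (u t : ℂ)) ⊆ Icc (-R) R) :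
    Tendsto (fun η : ℝ ↦ ccPairing (toMul fun t ↦ (1 + η) * u ((1 + η) * t))
          (toMul fun t ↦ (1 + η) * u ((1 + η) * t)) +
        1 / 2 * (∫ t, ‖(u t : ℂ)‖ ^ 2) * ((1 + η) * Real.log (1 + η)) +
        1 / 2 * (1 / 2 * (logLaplacianEnergy
            (weilConv (fun t ↦ (u t : ℂ)) (weilReflect fun t ↦ (u t : ℂ)))).re -
          Real.log (2 * Real.pi) * ∫ t, ‖(u t : ℂ)‖ ^ 2) * (1 + η) -
        1 / 8 * (massDstar (toMul fun t ↦ (1 + η) * u ((1 + η) * t)) *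
          massDu (toMul fun t ↦ (1 + η) * u ((1 + η) * t))))
      atTop (𝓝 0) := by
  have h1 := (tendsto_two_mul_ccPairing_approxDiagonal_add hu hsupp).const_mul (1 / 2)
  have h2 := ((tendsto_massDstar_approxDiagonal hu).mul
    (tendsto_massDu_approxDiagonal hu)).const_mul (1 / 8)
  have h := h1.sub h2
  rw [show 1 / 2 * (1 / 4 * (∫ t, u t) ^ 2) - 1 / 8 * ((∫ t, u t) * ∫ t, u t) = (0 : ℝ) by ring]
    at h
  refine h.congr' (Eventually.of_forall fun η ↦ ?_)
  simp only
  ring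

end Diagonal

end Summit.RiemannHypothesis.RiemannHypothesis.Theorems.MotivicDoor.ConnesConsani
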